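import Literature.Computability.QuantumComplexity.FactoringUP
import Literature.Computability.QuantumComplexity.FactoringPrimesProofs
import Literature.Computability.AlgebraicComplexity.BurgisserBooleanParts
import Literature.Computability.Cryptography.BlumMicaliMachine

/-!
# Route `LiouvilleSarnak`, item `LiouvilleInVNP` (stmt-ValiantsHypothesis-14777) — part 1/2:
# the polynomial-time verifier "`y` is the sorted prime factorisation of `⟦x⟧ + 1`, of even length"

The coefficient `λ(N)`, `N = Nat.ofBits e + 1`, of the Liouville family is `2·[Ω(N) even] - 1`, and
`[Ω(N) even]` is a `#P` function with a UNIQUE witness: the sorted prime factorisation of `N`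
(each prime certified by a polynomial-time primality test, `PRIMES ∈ P`, tree theorem
`PRIMES_mem_P_holds`). This file builds the verifier in the tree's `FP` brick algebra, on top of the
Fellows–Koblitz core test `FactUP.coreFn` of `QuantumComplexity/FactoringUP.lean`:

* `inKeyFn`, `inFn` — reshape the pair `⟨x, y⟩` (raw bit vector `x`) into the `FACT`-style input
  `⟨⟨encodeNat (⟦x⟧ + 1), encodeNat 0⟩, y⟩` of `coreFn`;
* `evenItemsFn` — the parity of the number of items of the coded list `y` (a fold flipping one bit);
* `lioFn R q = coreFn R q ∘ inFn ∧ evenItemsFn`, `LioLang R q = {w | lioFn R q w = [true]} ∈ P`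
  (`lioLang_mem_P`);
* `mem_lioLang_iff` — for an unambiguous primality verifier (`FactUP.IsPrimesUPVerifier R q wit`):
  `⟨x, y⟩ ∈ LioLang ↔ y = factWit wit (⟦x⟧ + 1) ∧ Even Ω(⟦x⟧ + 1)`;
* `certCount_lioLang` — hence the certificate count of `e ∈ {0,1}ⁿ` is EXACTLY `[Ω(ofBits e + 1) even]`
  once the certificate bound dominates `|factWit wit (ofBits e + 1)|`.

Part 2 (`LiouvilleSarnakLiouvilleInVNP.lean`) feeds this into Valiant's criterion in `#P` form
(`isVNPFamily_certCountGen`) and the `VNP` closure under linear combinations.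
HONEST FRAMING: bookkeeping (`Λ ∈ VNP`) for a dormant route; nothing here bears on `VP ≠ VNP`,
which is NOT proved.
-/

noncomputable section

-- layout Summits/ValiantsHypothesis/ValiantsHypothesis forces the duplicated namespace component
set_option linter.dupNamespace false

namespace Summit.ValiantsHypothesis.ValiantsHypothesis.Theorems.LiouvilleSarnak.LiouvilleVNP

open _root_.Computability Literature.Computability.Complexity Literature.Computability.Complexity.Classes
  Literature.Computability.Complexity.Nondeterministic Literature.Computability.Complexity.Brick Polynomial
open Literature.Computability.QuantumComplexity Literature.Computability.QuantumComplexity.FactUP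
open Literature.Computability.AlgebraicComplexity

/-! ### Reshaping the input -/

/-- `x ↦ ⟨encodeNat (⟦x⟧ + 1), encodeNat 0⟩`: the numeral of `N = ⟦x⟧ + 1` in the position where
`FactUP.coreFn` reads it. [folklore] -/
def inKeyFn : List Bool → List Bool :=
  fanoutFn (addFn ∘ fanoutFn (fun z => z) (fun _ => encodeNat 1)) (fun _ => encodeNat 0)

/-- Value of `inKeyFn`. [folklore] -/
theorem inKeyFn_apply (x : List Bool) :
    inKeyFn x = boolPair (encodeNat (bitsToNat x + 1)) (encodeNat 0) := by
  simp [inKeyFn]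

/-- `inKeyFn ∈ FP`. [folklore] -/
theorem inKeyFn_mem_FP : inKeyFn ∈ FP :=
  fanoutFn_mem_FP (comp_mem_FP addFn_mem_FP (fanoutFn_mem_FP (PolyTimeComputable.id _) (const_mem_FP _)))
    (const_mem_FP _)

/-- `⟨x, y⟩ ↦ ⟨inKeyFn x, y⟩`. [folklore] -/
def inFn : List Bool → List Bool := fanoutFn (inKeyFn ∘ fstF) sndF

/-- Value of `inFn` on a pair. [folklore] -/
theorem inFn_boolPair (x y : List Bool) : inFn (boolPair x y) = boolPair (inKeyFn x) y := by
  simp [inFn]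

/-- `inFn ∈ FP`. [folklore] -/
theorem inFn_mem_FP : inFn ∈ FP :=
  fanoutFn_mem_FP (comp_mem_FP inKeyFn_mem_FP fstF_mem_FP) sndF_mem_FP

/-! ### Parity of the number of items -/

/-- The fold step toggling the accumulator between `[]` ("even so far") and `[true]` ("odd so
far"); it reads `⟨w, ⟨item, acc⟩⟩`. [folklore] -/
def parStep : List Bool → List Bool :=
  iteFn (isNilFn ∘ sndF ∘ sndF) (fun _ => [true]) (fun _ => [])

/-- `parStep ∈ FP`. [folklore] -/
theorem parStep_mem_FP : parStep ∈ FP :=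
  iteFn_mem_FP (comp_mem_FP isNilFn_mem_FP (comp_mem_FP sndF_mem_FP sndF_mem_FP)) (const_mem_FP _)
    (const_mem_FP _)

/-- `parStep` returns at most one bit. [folklore] -/
theorem length_parStep_le (v : List Bool) : (parStep v).length ≤ 1 := by
  unfold parStep
  rw [iteFn_of_oneBit (oneBit_isNilFn.comp _)]
  split_ifs <;> simp

/-- `parStep` does not grow. [folklore] -/
theorem foldGrowth_parStep : FoldGrowth 1 parStep := fun v => by
  have := length_parStep_le v
  omega

/-- `parStep` toggles the accumulator. [folklore] -/
theorem parStep_boolPair (w a acc : List Bool) :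
    parStep (boolPair w (boolPair a acc)) = if acc = [] then [true] else [] := by
  unfold parStep
  rw [iteFn_of_oneBit (oneBit_isNilFn.comp _)]
  simp only [Function.comp_apply, sndF_boolPair, isNilFn_eq_true_iff]

/-- The parity fold: `[]` if the coded list `sndF w` has an even number of items, else `[true]`.
[folklore] -/
def parFold : List Bool → List Bool := foldFn parStep fun _ => []

/-- `parFold ∈ FP`. [folklore] -/
theorem parFold_mem_FP : parFold ∈ FP :=
  foldFn_mem_FP parStep_mem_FP (const_mem_FP _) foldGrowth_parStep

/-- The fold of `parStep`, from either state. [folklore] -/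
theorem foldl_parStep (w : List Bool) : ∀ (l : List (List Bool)) (acc : List Bool),
    (acc = [] ∨ acc = [true]) →
    l.foldl (fun acc a => parStep (boolPair w (boolPair a acc))) acc =
      if Even l.length then acc else (if acc = [] then [true] else [])
  | [], acc, _ => by simp
  | a :: l, acc, hacc => by
    rw [List.foldl_cons, parStep_boolPair,
      foldl_parStep w l _ (by split_ifs <;> simp)]
    simp only [List.length_cons, Nat.even_add_one]
    rcases hacc with rfl | rfl
    · by_cases h : Even l.length <;> simp [h]
    · by_cases h : Even l.length <;> simp [h]

/-- **Value of the parity fold.** [folklore] -/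
theorem parFold_apply (w : List Bool) :
    parFold w = if Even (decNil (sndF w)).length then [] else [true] := by
  rw [parFold, foldFn_apply, foldl_parStep w _ [] (Or.inl rfl)]
  simp

/-- The parity test: `[number of items of the coded list sndF w is even]`. [folklore] -/
def evenItemsFn : List Bool → List Bool := isNilFn ∘ parFold

/-- `evenItemsFn ∈ FP`. [folklore] -/
theorem evenItemsFn_mem_FP : evenItemsFn ∈ FP := comp_mem_FP isNilFn_mem_FP parFold_mem_FP

/-- **Value of the parity test.** [folklore] -/
theorem evenItemsFn_apply (w : List Bool) :
    evenItemsFn w = [decide (Even (decNil (sndF w)).length)] := by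
  simp only [evenItemsFn, Function.comp_apply, parFold_apply, isNilFn]
  by_cases h : Even (decNil (sndF w)).length <;> simp [h]

/-- The parity test is one-bit. [folklore] -/
theorem oneBit_evenItemsFn : OneBit evenItemsFn := fun w => ⟨_, evenItemsFn_apply w⟩

/-! ### The verifier -/

/-- **The Liouville verifier** on `⟨x, y⟩`: `y` passes the Fellows–Koblitz core test for
`N = ⟦x⟧ + 1` (sorted, certified prime keys with product `N`) and has an even number of items.
[folklore] -/
def lioFn (R : Language Bool) (q : Polynomial ℕ) : List Bool → List Bool :=
  andFn (coreFn R q ∘ inFn) evenItemsFn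

/-- `lioFn R q ∈ FP` for `R ∈ P`. [folklore] -/
theorem lioFn_mem_FP {R : Language Bool} (hR : R ∈ P) (q : Polynomial ℕ) : lioFn R q ∈ FP :=
  andFn_mem_FP (comp_mem_FP (coreFn_mem_FP hR q) inFn_mem_FP) evenItemsFn_mem_FP

/-- `lioFn R q` is one-bit. [folklore] -/
theorem oneBit_lioFn (R : Language Bool) (q : Polynomial ℕ) : OneBit (lioFn R q) :=
  oneBit_andFn ((oneBit_coreFn R q).comp _) oneBit_evenItemsFn

/-- **Truth of the verifier on a pair.** [folklore] -/
theorem lioFn_boolPair_eq_true_iff (R : Language Bool) (q : Polynomial ℕ) (x y : List Bool) :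
    lioFn R q (boolPair x y) = [true] ↔
      coreFn R q (boolPair (inKeyFn x) y) = [true] ∧ Even (decNil y).length := by
  rw [lioFn, andFn_eq_true_iff ((oneBit_coreFn R q).comp _) oneBit_evenItemsFn]
  simp only [Function.comp_apply, inFn_boolPair, evenItemsFn_apply, sndF_boolPair,
    List.singleton_inj, decide_eq_true_eq]

/-- The language of the Liouville verifier. [folklore] -/
def LioLang (R : Language Bool) (q : Polynomial ℕ) : Language Bool := {w | lioFn R q w = [true]}

/-- **The verifier language is in `P`** (for `R ∈ P`). [folklore] -/
theorem lioLang_mem_P {R : Language Bool} (hR : R ∈ P) (q : Polynomial ℕ) : LioLang R q ∈ P :=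
  mem_P_of_mem_FP (lioFn_mem_FP hR q) _ fun _ =>
    ⟨fun h => h, fun h => (oneBit_lioFn R q).eq_false_of_ne_true h⟩

/-! ### The unique witness and the certificate count -/

section Count

variable {R : Language Bool} {q : Polynomial ℕ} {wit : ℕ → List Bool}

/-- The number of items of the witness is `Ω(N)`. [folklore] -/
theorem length_decNil_factWit (wit : ℕ → List Bool) (N : ℕ) :
    (decNil (factWit wit N)).length = ArithmeticFunction.cardFactors N := by
  rw [factWit, decNil_encItems, List.length_map, List.length_map,
    ArithmeticFunction.cardFactors_apply]

/-- **Membership in the verifier language**: for an unambiguous primality verifier, `⟨x, y⟩` is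
accepted iff `y` is THE witness of `N = ⟦x⟧ + 1` and `Ω(N)` is even. [folklore] -/
theorem mem_lioLang_iff (hV : IsPrimesUPVerifier R q wit) (x y : List Bool) :
    boolPair x y ∈ LioLang R q ↔
      y = factWit wit (bitsToNat x + 1) ∧ Even (ArithmeticFunction.cardFactors (bitsToNat x + 1)) := by
  show lioFn R q (boolPair x y) = [true] ↔ _
  rw [lioFn_boolPair_eq_true_iff]
  constructor
  · rintro ⟨hcore, heven⟩
    obtain ⟨_, hy⟩ := eq_factWit_of_coreFn hV hcore
    rw [inKeyFn_apply, fstF_boolPair, bitsToNat_encodeNat] at hy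
    refine ⟨hy, ?_⟩
    rwa [hy, length_decNil_factWit] at heven
  · rintro ⟨rfl, heven⟩
    refine ⟨?_, by rwa [length_decNil_factWit]⟩
    rw [inKeyFn_apply]
    exact coreFn_factWit hV (Nat.succ_ne_zero _) 0

/-- **The certificate count is the parity indicator**: if the bound `pf n` dominates the witness
length, then `certCount pf (LioLang R q) n e = [Ω(ofBits e + 1) even]`. [folklore] -/
theorem certCount_lioLang (hV : IsPrimesUPVerifier R q wit) {pf : ℕ → ℕ} {n : ℕ}
    (e : Fin n → Bool) (hpf : (factWit wit (Nat.ofBits e + 1)).length ≤ pf n) :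
    certCount pf (LioLang R q) n e =
      if Even (ArithmeticFunction.cardFactors (Nat.ofBits e + 1)) then 1 else 0 := by
  classical
  unfold certCount
  set W := factWit wit (Nat.ofBits e + 1) with hW
  have hmem : ∀ (m : ℕ) (y : Fin m → Bool),
      boolPair (List.ofFn e) (List.ofFn y) ∈ LioLang R q ↔
        List.ofFn y = W ∧ Even (ArithmeticFunction.cardFactors (Nat.ofBits e + 1)) := by
    intro m y
    rw [mem_lioLang_iff hV, Literature.Computability.Cryptography.BMMachine.bitsToNat_ofFn]
  by_cases hev : Even (ArithmeticFunction.cardFactors (Nat.ofBits e + 1))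
  · rw [if_pos hev]
    rw [Finset.sum_eq_single W.length]
    · -- exactly one certificate of the right length
      have hfilter : (Finset.univ.filter fun y : Fin W.length → Bool =>
          boolPair (List.ofFn e) (List.ofFn y) ∈ LioLang R q) = {fun i => W.get i} := by
        ext y
        simp only [Finset.mem_filter, Finset.mem_univ, true_and, Finset.mem_singleton, hmem,
          hev, and_true]
        constructor
        · intro hy
          exact List.ofFn_injective (hy.trans (List.ofFn_get W).symm)
        · rintro rfl
          exact List.ofFn_get W
      rw [hfilter, Finset.card_singleton]
    · intro m _ hm
      refine Finset.card_eq_zero.2 (Finset.filter_eq_empty_iff.2 fun y _ => ?_)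
      rw [hmem]
      rintro ⟨hy, _⟩
      exact hm (by rw [← hy, List.length_ofFn])
    · intro h
      exact absurd (Finset.mem_range.2 (Nat.lt_succ_of_le hpf)) h
  · rw [if_neg hev]
    refine Finset.sum_eq_zero fun m _ => ?_
    refine Finset.card_eq_zero.2 (Finset.filter_eq_empty_iff.2 fun y _ => ?_)
    rw [hmem]
    exact fun h => hev h.2

end Count

end Summit.ValiantsHypothesis.ValiantsHypothesis.Theorems.LiouvilleSarnak.LiouvilleVNP
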